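import Literature.MathematicalPhysics.QuantumFieldTheory.QCDOS
import Literature.MathematicalPhysics.QuantumLattice.GrassmannGaussianMeasureChange
import HarnessLib

/-!
# Stub `stub_fermiBoltzmann_update` of line `pin-the-infimum`
(crux `Summit.QuantumFields.QCD.Theses.HeatSlicedQuarks.RobustYangMillsHandover`,
item stmt-QuantumFields-8892; Grassmann-algebraic half of the Feynman–Hellmann identity
`QuarkMassMonotone.MassDerivativeIdentity`, item stmt-QuantumFields-8909)

**Updating one bare quark mass multiplies the fermionic Boltzmann factor by the exponential of
the flavour scalar density.**  For `N_f` Wilson flavours on the four-torus of side `S`: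

* the `N_f`-flavour Wilson–Dirac matrix is affine in each bare mass, with slope the flavour
  projector: `D(U, m[f ↦ μ]) = D(U, m) + (μ − m_f) P_f`, `P_f = diag(1_{flavour = f})`
  (`diracMatrix_update`; the bare mass sits on the diagonal of `wilsonDirac` only);
* the quadratic action `ψ̄Aψ` is linear in `A` and central, so
  `e^{−ψ̄ D(U, m[f ↦ μ]) ψ} = e^{−ψ̄ D(U, m) ψ} · e^{−(μ − m_f) ψ̄ P_f ψ}`
  (tree `grassmannExp_quadratic_add`, `quadratic_neg`, `quadratic_smul`);
* `ψ̄ P_f ψ = Σ_{x,a,α} ψ̄_{f,x,a,α} ψ_{f,x,a,α}` is the flavour-`f` scalar density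
  (`quadratic_flavourProj`: off-diagonal terms vanish, then the sum over the enumeration
  `FermiIdx` is pulled back along `quarkEquiv` and the flavours `≠ f` drop out).

Pure finite-dimensional Grassmann algebra over the tree definitions `diracMatrix`,
`fermiBoltzmann`, `qbar`, `q`, `quadratic`, `grassmannExp`.
-/

noncomputable section

namespace Summit.QuantumFields.QCD.Cruxes.RobustYangMillsHandover.PinTheInfimum

open MeasureTheory Filter Function Matrix
open Literature.MathematicalPhysics.QuantumFieldTheory Literature.MathematicalPhysics.QuantumLattice
open Literature.Probability.LatticeModels

namespace StubFermiBoltzmannUpdate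

variable {Nf S : ℕ}

/-- The bare mass enters the Wilson–Dirac matrix on the diagonal only:
`D_W(U, μ, r)_{pp'} = D_W(U, m, r)_{pp'} + (μ − m) δ_{pp'}` (Montvay–Münster (4.85)). [folklore] -/
theorem wilsonDirac_apply_mass_shift {G : Type*} [Group G] {N : ℕ}
    (ρ : G →* Matrix (Fin N) (Fin N) ℂ) (U : GaugeConfig 4 S G) (m μ r : ℝ)
    (p p' : TorusSite 4 S × Fin N × Fin 4) :
    wilsonDirac ρ U μ r p p' =
      wilsonDirac ρ U m r p p' + if p = p' then ((μ - m : ℝ) : ℂ) else 0 := by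
  simp only [wilsonDirac, Matrix.of_apply]
  split_ifs <;> push_cast <;> ring

variable [NeZero S]

/-- **The `N_f`-flavour Dirac matrix is affine in each bare mass**:
`D(U, m[f ↦ μ]) = D(U, m) + (μ − m_f) P_f`, `P_f` the diagonal projector onto the variables of
flavour `f`. [folklore] -/
theorem diracMatrix_update (U : GaugeConfig 4 S (Matrix.specialUnitaryGroup (Fin 3) ℂ))
    (mq : Fin Nf → ℝ) (f : Fin Nf) (μ : ℝ) :
    diracMatrix U (Function.update mq f μ) =
      diracMatrix U mq + ((μ - mq f : ℝ) : ℂ) •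
        Matrix.diagonal fun i : FermiIdx Nf S =>
          if (quarkEquiv.symm i).1 = f then (1 : ℂ) else 0 := by
  ext i j
  obtain ⟨⟨f₁, p⟩, rfl⟩ := quarkEquiv.surjective i
  obtain ⟨⟨f₂, p'⟩, rfl⟩ := quarkEquiv.surjective j
  simp only [diracMatrix, Matrix.reindex_apply, Matrix.submatrix_apply, Matrix.of_apply,
    Equiv.symm_apply_apply, Matrix.add_apply, Matrix.smul_apply, Matrix.diagonal_apply,
    EmbeddingLike.apply_eq_iff_eq, Prod.mk.injEq, smul_eq_mul]
  by_cases hf : f₁ = f₂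
  · subst hf
    rw [wilsonDirac_apply_mass_shift (fundamentalRep (Fin 3)) U (mq f₁)
      (Function.update mq f μ f₁) 1 p p']
    by_cases hff : f₁ = f
    · subst hff
      simp only [Function.update_self, true_and, if_true, mul_ite, mul_one, mul_zero]
    · simp [hff]
  · simp [hf]

/-- **The flavour scalar density as a quadratic action**:
`ψ̄ P_f ψ = Σ_{x,a,α} ψ̄_{f,x,a,α} ψ_{f,x,a,α}`. [folklore] -/
theorem quadratic_flavourProj (f : Fin Nf) :
    quadratic ℂ (Matrix.diagonal fun i : FermiIdx Nf S =>
        if (quarkEquiv.symm i).1 = f then (1 : ℂ) else 0) =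
      ∑ x : TorusSite 4 S, ∑ a : Fin 3, ∑ α : Fin 4, qbar (f, (x, a, α)) * q (f, (x, a, α)) := by
  have h1 : quadratic ℂ (Matrix.diagonal fun i : FermiIdx Nf S =>
      if (quarkEquiv.symm i).1 = f then (1 : ℂ) else 0) =
      ∑ i : FermiIdx Nf S,
        (if (quarkEquiv.symm i).1 = f then (1 : ℂ) else 0) • (psiBar ℂ i * psi ℂ i) := by
    unfold quadratic
    refine Finset.sum_congr rfl fun i _ => ?_
    rw [Finset.sum_eq_single i]
    · rw [Matrix.diagonal_apply_eq]
    · intro j _ hj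
      rw [Matrix.diagonal_apply_ne _ (Ne.symm hj), zero_smul]
    · intro h
      exact absurd (Finset.mem_univ i) h
  rw [h1, ← Equiv.sum_comp quarkEquiv]
  simp only [Equiv.symm_apply_apply, ite_smul, one_smul, zero_smul]
  rw [Fintype.sum_prod_type, Fintype.sum_eq_single f fun g hg => by simp [hg]]
  simp only [if_true, Fintype.sum_prod_type]
  rfl

end StubFermiBoltzmannUpdate

open StubFermiBoltzmannUpdate in
/-- **W1a: the mass update of the fermionic Boltzmann factor splits off the flavour-`f` scalar
density.**  (1) `ψ̄ P_f ψ = Σ_{x,a,α} ψ̄_{f,x,a,α} ψ_{f,x,a,α}`; (2) for every `SU(3)` field `U` and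
every `μ`, `e^{−ψ̄ D(U, m[f ↦ μ]) ψ} = e^{−ψ̄ D(U, m) ψ} · exp(−(μ − m_f) Σ_{x,a,α} ψ̄_{f,x,a,α} ψ_{f,x,a,α})`.
[folklore] -/
theorem stub_fermiBoltzmann_update :
    ∀ (Nf S : ℕ) [NeZero S] (mq : Fin Nf → ℝ) (f : Fin Nf),
      (quadratic ℂ (Matrix.diagonal fun i : FermiIdx Nf S =>
          if (quarkEquiv.symm i).1 = f then (1 : ℂ) else 0) =
          ∑ x : TorusSite 4 S, ∑ a : Fin 3, ∑ α : Fin 4, qbar (f, (x, a, α)) * q (f, (x, a, α))) ∧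
      ∀ (U : GaugeConfig 4 S (Matrix.specialUnitaryGroup (Fin 3) ℂ)) (μ : ℝ),
        fermiBoltzmann U (Function.update mq f μ) =
          fermiBoltzmann U mq *
            grassmannExp (-(((μ - mq f : ℝ) : ℂ) •
              ∑ x : TorusSite 4 S, ∑ a : Fin 3, ∑ α : Fin 4,
                qbar (f, (x, a, α)) * q (f, (x, a, α)))) := by
  intro Nf S _ mq f
  refine ⟨quadratic_flavourProj f, fun U μ => ?_⟩
  rw [fermiBoltzmann, fermiBoltzmann, diracMatrix_update U mq f μ, neg_add,
    grassmannExp_quadratic_add, ← neg_smul, quadratic_smul, quadratic_flavourProj, neg_smul]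

end Summit.QuantumFields.QCD.Cruxes.RobustYangMillsHandover.PinTheInfimum
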